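import Mathlib
import HarnessLib
import Summits.Ventures.LatticeQCDFlow.Exactness.IMHKernel

/-!
# Metropolis–Hastings with a STATE-DEPENDENT proposal density on a general state space is exact: for a proposal `κ(x, y)μ(dy)` and a target
# `p·μ`, accepting with `min(1, p(y)κ(y, x)/(p(x)κ(x, y)))` is in detailed balance — conditional flows `q(·|x)` included

HONEST FRAMING: exact (Metropolis-corrected) sampling algorithms for lattice gauge theory;
figures of merit are autocorrelation/cost numbers at stated couplings and volumes; no
continuum-physics claim.

Venture `LatticeQCDFlow` (cell pub-lqcd), topic `Exactness`; FANOUT row 30 (lean-1, GEN-42).  NEW WORK of the cell over Mathlib (Tonelli,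
`Kernel.IsReversible`) and the tree's `IMHKernel` vocabulary.  The tree types three general-space cases: the INDEPENDENCE sampler (`IMHKernel`:
proposal a fixed law `q`), SYMMETRIC proposal kernels (`SymmetricMetropolis`), DETERMINISTIC involutions (`InvolutiveMetropolis`); the Hastings
case — an arbitrary proposal DENSITY `κ(x, y)` against a reference `μ` (σ-finite; Haar, Lebesgue) — is typed here, DEF-FREE: the sampler is any
Markov kernel `K` with `K(x, B) = ∫_B b(x, y) μ(dy) + (1 − ∫ b(x, y) μ(dy))·1_B(x)` for a sub-probability transition density `b` (hypothesis `hK`).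
Printed counterpart, named only: Tierney 1998 §2.  The flow case: a CONDITIONAL flow `q(·|x)` with tractable density `κ(x, ·)` (proposals
that depend on the current configuration) corrected by the Hastings ratio.

## Results (no `sorry`, no new definitions)
* §1 (any reference `μ`, s-finite; any measurable `b ≥ 0`): `densityKernel_setLIntegral` — the mass flow `∫_A K(x, B) (p·μ)(dx)` splits into
  `∫_A∫_B p(x)b(x, y) μ(dy)μ(dx)` plus a diagonal term symmetric in `(A, B)`; **`densityKernel_isReversible`** — FLUX SYMMETRY
  `p(x)b(x, y) = p(y)b(y, x)` ⇒ detailed balance with `p·μ`; **`densityKernel_invariant`**.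
* §2 THE HASTINGS RULE: `b(x, y) = κ(x, y)·min(1, p(y)κ(y, x)/(p(x)κ(x, y)))` for positive measurable `p`, `κ`: `hastings_flux`
  (`p(x)b(x, y) = min(p(x)κ(x, y), p(y)κ(y, x))`), `hastings_flux_symm`, `measurable_hastings`, **`metropolisHastings_isReversible`**,
  **`metropolisHastings_invariant`** — EXACT FOR EVERY POSITIVE PROPOSAL DENSITY AND EVERY POSITIVE TARGET DENSITY; `hastings_le_proposal`
  (`b ≤ κ`: the rule is a thinning of the proposal, so `∫ b dμ ≤ 1` when `κ(x, ·)` is a probability density, `hastings_mass_le_one`).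
Reading (gauge files): a flow whose output law depends on the current gauge field (a learned proposal KERNEL rather than a fixed model) is
corrected exactly by the Hastings ratio of the two conditional densities and the two Boltzmann weights, on the continuous group, for any
reference measure.  NOT CLAIMED: anything for proposals without a density (deterministic maps: `InvolutiveMetropolis`); rates.
-/

noncomputable section

namespace Summit.Ventures.LatticeQCDFlow.Exactness

open MeasureTheory ProbabilityTheory
open scoped ENNReal

variable {Ω : Type*} [MeasurableSpace Ω] {μ : Measure Ω} [SFinite μ] {p : Ω → ℝ}

/-! ## §1 Transition densities against a reference measure: flux symmetry ⇒ detailed balance -/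

/-- **THE MASS FLOW of a density kernel**: for `π = p·μ` and `K(x, B) = ∫_B b(x, y) μ(dy) + (1 − ∫ b(x, ·) dμ)·1_B(x)`,
`∫_A K(x, B) π(dx) = ∫_A ∫_B p(x)b(x, y) μ(dy) μ(dx) + ∫_{B ∩ A} p(x)(1 − ∫ b(x, ·) dμ) μ(dx)`. [ours] -/
theorem densityKernel_setLIntegral (hp : Measurable p) {b : Ω → Ω → ℝ≥0∞} (hb : Measurable (Function.uncurry b))
    (K : Kernel Ω Ω) (hK : ∀ (x : Ω) {B : Set Ω}, MeasurableSet B → K x B = ∫⁻ y in B, b x y ∂μ + (1 - ∫⁻ y, b x y ∂μ) * B.indicator 1 x)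
    {A B : Set Ω} (hA : MeasurableSet A) (hB : MeasurableSet B) :
    ∫⁻ x in A, K x B ∂(μ.withDensity fun x => ENNReal.ofReal (p x)) =
      (∫⁻ x in A, ∫⁻ y in B, ENNReal.ofReal (p x) * b x y ∂μ ∂μ) +
        ∫⁻ x in B ∩ A, ENNReal.ofReal (p x) * (1 - ∫⁻ y, b x y ∂μ) ∂μ := by
  have hd : Measurable fun x => ENNReal.ofReal (p x) := hp.ennreal_ofReal
  have hKm : Measurable fun x => K x B := Kernel.measurable_coe _ hB
  have hmass : Measurable fun x => ∫⁻ y, b x y ∂μ := hb.lintegral_prod_right'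
  have hR : Measurable fun x => 1 - ∫⁻ y, b x y ∂μ := measurable_const.sub hmass
  rw [setLIntegral_withDensity_eq_setLIntegral_mul _ hd hKm hA]
  simp only [Pi.mul_apply]
  have hpt : ∀ x, ENNReal.ofReal (p x) * K x B =
      ENNReal.ofReal (p x) * ∫⁻ y in B, b x y ∂μ + B.indicator (fun x => ENNReal.ofReal (p x) * (1 - ∫⁻ y, b x y ∂μ)) x := by
    intro x
    rw [hK x hB, mul_add]
    congr 1
    by_cases hx : x ∈ B
    · rw [Set.indicator_of_mem hx, Set.indicator_of_mem hx, Pi.one_apply, mul_one]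
    · rw [Set.indicator_of_notMem hx, Set.indicator_of_notMem hx, mul_zero, mul_zero]
  simp_rw [hpt]
  have hind : Measurable (B.indicator fun x => ENNReal.ofReal (p x) * (1 - ∫⁻ y, b x y ∂μ)) := (hd.mul hR).indicator hB
  rw [lintegral_add_right _ hind, lintegral_indicator hB, Measure.restrict_restrict hB]
  congr 1
  refine lintegral_congr fun x => ?_
  rw [← lintegral_const_mul _ hb.of_uncurry_left]

/-- **FLUX SYMMETRY ⇒ DETAILED BALANCE** for density kernels: `p(x)b(x, y) = p(y)b(y, x)` for all `x, y` ⇒ `K` is reversible for `p·μ`. [ours] -/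
theorem densityKernel_isReversible (hp : Measurable p) {b : Ω → Ω → ℝ≥0∞} (hb : Measurable (Function.uncurry b))
    (hsym : ∀ x y, ENNReal.ofReal (p x) * b x y = ENNReal.ofReal (p y) * b y x)
    (K : Kernel Ω Ω) (hK : ∀ (x : Ω) {B : Set Ω}, MeasurableSet B → K x B = ∫⁻ y in B, b x y ∂μ + (1 - ∫⁻ y, b x y ∂μ) * B.indicator 1 x) :
    Kernel.IsReversible K (μ.withDensity fun x => ENNReal.ofReal (p x)) := by
  intro A B hA hB
  rw [densityKernel_setLIntegral hp hb K hK hA hB, densityKernel_setLIntegral hp hb K hK hB hA, Set.inter_comm]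
  congr 1
  have hs : Measurable (Function.uncurry fun x y : Ω => ENNReal.ofReal (p x) * b x y) := (hp.ennreal_ofReal.comp measurable_fst).mul hb
  rw [lintegral_lintegral_swap (hs.aemeasurable (μ := (μ.restrict A).prod (μ.restrict B)))]
  refine lintegral_congr fun y => lintegral_congr fun x => ?_
  exact hsym x y

/-- … hence `p·μ` is invariant. [ours] -/
theorem densityKernel_invariant (hp : Measurable p) {b : Ω → Ω → ℝ≥0∞} (hb : Measurable (Function.uncurry b))
    (hsym : ∀ x y, ENNReal.ofReal (p x) * b x y = ENNReal.ofReal (p y) * b y x)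
    (K : Kernel Ω Ω) [IsMarkovKernel K]
    (hK : ∀ (x : Ω) {B : Set Ω}, MeasurableSet B → K x B = ∫⁻ y in B, b x y ∂μ + (1 - ∫⁻ y, b x y ∂μ) * B.indicator 1 x) :
    Kernel.Invariant K (μ.withDensity fun x => ENNReal.ofReal (p x)) :=
  (densityKernel_isReversible hp hb hsym K hK).invariant

/-! ## §2 The Hastings rule for a proposal density -/

variable {κ : Ω → Ω → ℝ}

omit [MeasurableSpace Ω] in
/-- **The Hastings flux**: `p(x)·κ(x, y)·min(1, p(y)κ(y, x)/(p(x)κ(x, y))) = min(p(x)κ(x, y), p(y)κ(y, x))`. [ours] -/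
theorem hastings_flux (hp0 : ∀ x, 0 < p x) (hκ0 : ∀ x y, 0 < κ x y) (x y : Ω) :
    p x * (κ x y * min 1 (p y * κ y x / (p x * κ x y))) = min (p x * κ x y) (p y * κ y x) := by
  have hpk : 0 < p x * κ x y := mul_pos (hp0 x) (hκ0 x y)
  rw [← mul_assoc, mul_min_of_nonneg _ _ hpk.le, mul_one, mul_div_cancel₀ _ hpk.ne']

omit [MeasurableSpace Ω] in
/-- … which is symmetric: the `ℝ≥0∞` flux symmetry of the Hastings rule. [ours] -/
theorem hastings_flux_symm (hp0 : ∀ x, 0 < p x) (hκ0 : ∀ x y, 0 < κ x y) (x y : Ω) :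
    ENNReal.ofReal (p x) * ENNReal.ofReal (κ x y * min 1 (p y * κ y x / (p x * κ x y))) =
      ENNReal.ofReal (p y) * ENNReal.ofReal (κ y x * min 1 (p x * κ x y / (p y * κ y x))) := by
  rw [← ENNReal.ofReal_mul (hp0 x).le, ← ENNReal.ofReal_mul (hp0 y).le, hastings_flux hp0 hκ0, hastings_flux hp0 hκ0, min_comm]

/-- The Hastings transition density is jointly measurable. [ours, bookkeeping] -/
theorem measurable_hastings (hp : Measurable p) (hκ : Measurable (Function.uncurry κ)) :
    Measurable (Function.uncurry fun x y : Ω => ENNReal.ofReal (κ x y * min 1 (p y * κ y x / (p x * κ x y)))) := by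
  have hκ' : Measurable fun z : Ω × Ω => κ z.2 z.1 := hκ.comp (measurable_snd.prodMk measurable_fst)
  exact (hκ.mul (measurable_const.min (((hp.comp measurable_snd).mul hκ').div ((hp.comp measurable_fst).mul hκ)))).ennreal_ofReal

omit [MeasurableSpace Ω] in
/-- The Hastings rule is a thinning of the proposal: `b(x, y) ≤ κ(x, y)`. [ours, bookkeeping] -/
theorem hastings_le_proposal (hκ0 : ∀ x y, 0 < κ x y) (x y : Ω) :
    ENNReal.ofReal (κ x y * min 1 (p y * κ y x / (p x * κ x y))) ≤ ENNReal.ofReal (κ x y) := by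
  refine ENNReal.ofReal_le_ofReal ?_
  calc κ x y * min 1 (p y * κ y x / (p x * κ x y)) ≤ κ x y * 1 := mul_le_mul_of_nonneg_left (min_le_left _ _) (hκ0 x y).le
    _ = κ x y := mul_one _


omit [SFinite μ] in
/-- … so its total mass is at most one when `κ(x, ·)` is a probability density. [ours, bookkeeping] -/
theorem hastings_mass_le_one (hκ0 : ∀ x y, 0 < κ x y) (hκ1 : ∀ x, ∫⁻ y, ENNReal.ofReal (κ x y) ∂μ = 1) (x : Ω) :
    ∫⁻ y, ENNReal.ofReal (κ x y * min 1 (p y * κ y x / (p x * κ x y))) ∂μ ≤ 1 := by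
  calc ∫⁻ y, ENNReal.ofReal (κ x y * min 1 (p y * κ y x / (p x * κ x y))) ∂μ ≤ ∫⁻ y, ENNReal.ofReal (κ x y) ∂μ :=
        lintegral_mono fun y => hastings_le_proposal hκ0 x y
    _ = 1 := hκ1 x

/-- **METROPOLIS–HASTINGS WITH A PROPOSAL DENSITY IS EXACT ON A GENERAL STATE SPACE**: for every positive measurable target density `p` and
proposal density `κ` against `μ`, any Markov kernel that proposes `y ∼ κ(x, y)μ(dy)`, accepts with `min(1, p(y)κ(y, x)/(p(x)κ(x, y)))` and otherwise
stays is reversible for `p·μ` … [ours] -/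
theorem metropolisHastings_isReversible (hp : Measurable p) (hp0 : ∀ x, 0 < p x) (hκ : Measurable (Function.uncurry κ))
    (hκ0 : ∀ x y, 0 < κ x y) (K : Kernel Ω Ω)
    (hK : ∀ (x : Ω) {B : Set Ω}, MeasurableSet B → K x B =
      ∫⁻ y in B, ENNReal.ofReal (κ x y * min 1 (p y * κ y x / (p x * κ x y))) ∂μ +
        (1 - ∫⁻ y, ENNReal.ofReal (κ x y * min 1 (p y * κ y x / (p x * κ x y))) ∂μ) * B.indicator 1 x) :
    Kernel.IsReversible K (μ.withDensity fun x => ENNReal.ofReal (p x)) :=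
  densityKernel_isReversible hp (measurable_hastings hp hκ) (hastings_flux_symm hp0 hκ0) K hK

/-- … **and leaves `p·μ` invariant**. [ours] -/
theorem metropolisHastings_invariant (hp : Measurable p) (hp0 : ∀ x, 0 < p x) (hκ : Measurable (Function.uncurry κ))
    (hκ0 : ∀ x y, 0 < κ x y) (K : Kernel Ω Ω) [IsMarkovKernel K]
    (hK : ∀ (x : Ω) {B : Set Ω}, MeasurableSet B → K x B =
      ∫⁻ y in B, ENNReal.ofReal (κ x y * min 1 (p y * κ y x / (p x * κ x y))) ∂μ +
        (1 - ∫⁻ y, ENNReal.ofReal (κ x y * min 1 (p y * κ y x / (p x * κ x y))) ∂μ) * B.indicator 1 x) :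
    Kernel.Invariant K (μ.withDensity fun x => ENNReal.ofReal (p x)) :=
  (metropolisHastings_isReversible hp hp0 hκ hκ0 K hK).invariant

end Summit.Ventures.LatticeQCDFlow.Exactness
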